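import Literature.AnabelianGeometry.EtaleTheta.Discharge.Sec5Def54bAtPinnedQ
import Literature.AnabelianGeometry.EtaleTheta.Discharge.Sec1ZNThetaImageInfDeltaTheta
import HarnessLib

/-!
# [EtTh] Def. 5.4 (b) at the single-underline SETTING PIN for the Galois objects `Π^tp_X/Π^tp_{Z_{l·N}}` and
# `Π^tp_X/Π^tp_{Z̈_{l·N}}`: `#((l·Δ_Θ)_{Π/Z_{l·N}} ⊗ ℤ/Nℤ) = N` (proof-only knit of p502778 with p505413)

Mochizuki, *The étale theta function and its Frobenioid-theoretic manifestations*, Publ. RIMS **45** (2009) [EtTh], Def. 5.4 (b)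
p. 327 (PDF p. 101) «(b) `(l·Δ_Θ)_S ⊗ ℤ/Nℤ` is of cardinality `N`»; §1 p. 14 / p. 20 (the coverings `Z_N`, `Z̈_N`: «`Δ^tp_{Ÿ_N}/Δ^tp_{Z̈_N}
≅ Δ_Θ ⊗ ℤ/Nℤ`») [cite: MochizukiEtTh2009, Def 5.4 p.327 (PDF p.101)].

abc-iut cell, layer L2 = [EtTh], seat abc-iut-w6-d061 (gen 9), row «DEF54b@SETTING-PIN-ZN» = the «Setting-pin knit» left BY NAME by
abc-iut-L2-t4 g9 (HANDOFF block #2, 06:43:59Z: «(b) at the ThetaSetting pin for V := GtpZ̈N ⟸ w6-d061's `lDeltaTheta_inf_map_toTheta_gtpZN`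
= one application of p502778»).  PROOF-ONLY: no definition, no instance, no notation, no new `Prop`; nothing landed is edited or restated.
Consumed BY NAME: abc-iut-L2-t9's pin `ThetaSubquotient.ofSetting` / `lDeltaQEquivOfSetting` (single underline case, `q := Π^tp_X ↠
(Π^tp_X)^Θ` onto), abc-iut-L2-t4's `ThetaSubquotientStub.card_lDelta_quotient_pow_eq_iff_dvd` (p502778), abc-iut-L2-t8's `ThetaSetting.CyclotomeMod`
(`red`, `red_ker`) and `card_MuN`, this seat's `ThetaSetting.map_toTheta_gtpZN_inf_deltaTheta` / `map_toTheta_gtpZddN_inf_deltaTheta` (p505413).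

WHAT IS PROVED.  For `D : ThetaSetting p` under the freeness guard `hO : D.IsEtThOrigin`, with `Π^tp_X` tempered (`hT`, displayed as in
abc-iut-L2-t9's `lDeltaQEquivOfSetting`), `l, N ≥ 1`, a cyclotome datum `μ : D.CyclotomeMod l N` (supplies `#(l·Δ_Θ ⧸ N·(l·Δ_Θ)) = N`), and the
∃-form of the `Z_{l·N}` origin clause (a lifted splitting `s₀` cutting out `Π^tp_{Z_{l·N}}` — abc-iut-L2-t1's `GtpZNFromSplitting`):
* `ThetaSetting.lDeltaTheta_inf_eq_pow_of_deltaTheta_inf` — bookkeeping: `W ∩ Δ_Θ = (l·N)·Δ_Θ ⇒ l·Δ_Θ ∩ W = (l·N)·Δ_Θ`;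
* `ThetaSetting.comap_ιTheta_eq_ker_red_of_inf_eq` — (★) in abc-iut-L2-t4's currency: if `l·Δ_Θ ∩ W = (l·N)·Δ_Θ` then
  `ι⁻¹(W ∩ l·Δ_Θ) = Ker(μ.red)` inside `l·Δ_Θ`;
* **`ThetaSubquotient.card_lDeltaModN_ofSetting_gtpZN`** — for any `V : OpenNormalSubgroup Π^tp_X` with the DISPLAYED equation
  `V = Π^tp_{Z_{l·N}}`: `Nat.card ((l·Δ_Θ)_{Π/V} ⧸ N-th powers) = N` — Def. 5.4 (b) TRUE at the pin for this Galois object;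
* **`ThetaSubquotient.card_lDeltaModN_ofSetting_gtpZddN`** — the same for `V = Π^tp_{Z̈_{l·N}}` given `Δ_Θ ≤ θ(Δ^tp_{Y_{2lN}})`, and
  `…_of_isTateOrigin` discharging that input at Tate origins (R2 at every level + a cusp).
(The equation `V.toSubgroup = D.GtpZN (l·N)` is a hypothesis only to keep the file free of an `OpenNormalSubgroup` packaging `def`; the
root fields `isOpen_GtpZN` / `GtpZN_normal` inhabit it.)
HONEST FRAMING: clause (b) at OUR root record's pin under a DISPLAYED origin clause; no §5 datum (`ThetaFrobenioid.IsThetaSaturated`) is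
instantiated here; [EtTh] is refereed; nothing here bears on [IUTchIII] Cor. 3.12; no side taken; typed ≠ proved.
-/

noncomputable section

namespace Literature.AnabelianGeometry.EtaleTheta

open CategoryTheory Literature.AlgebraicGeometry.Frobenioids Literature.AnabelianGeometry.SemiGraphs
open scoped IsMulCommutative

namespace ThetaSetting

variable {p : ℕ} [Fact p.Prime] (D : ThetaSetting p)

/-- Bookkeeping: if a subgroup `W ⊆ (Π^tp_X)^Θ` meets `Δ_Θ` in `(l·N)·Δ_Θ`, it meets `l·Δ_Θ` in `(l·N)·Δ_Θ` as well
(`(l·N)·Δ_Θ ≤ l·Δ_Θ ≤ Δ_Θ`). [cite: MochizukiEtTh2009, Prop 2.12 (i) p.45] -/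
theorem lDeltaTheta_inf_eq_pow_of_deltaTheta_inf (l N : ℕ+) {W : Subgroup D.GtpTheta}
    (hW : W ⊓ D.DeltaTheta = D.lDeltaTheta (l * N)) : D.lDeltaTheta l ⊓ W = D.lDeltaTheta (l * N) := by
  apply le_antisymm
  · rintro t ⟨htl, htW⟩
    have : t ∈ W ⊓ D.DeltaTheta := ⟨htW, D.lDeltaTheta_le l htl⟩
    rwa [hW] at this
  · intro t ht
    refine ⟨D.lDeltaTheta_mul_le N l ht, ?_⟩
    rw [← hW] at ht
    exact ht.1

/-- **(★) in the pinned-stub currency**: if `l·Δ_Θ ∩ W = (l·N)·Δ_Θ` then, inside `l·Δ_Θ`, `ι⁻¹(W ∩ l·Δ_Θ) = Ker(red)` for every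
cyclotome datum `μ : CyclotomeMod l N` (`red : l·Δ_Θ ↠ μ_N` has kernel the `N`-th powers; `(d^l)^N = d^{l·N}`).
[cite: MochizukiEtTh2009, Def 2.13 p.272 (PDF p.46)] -/
theorem comap_ιTheta_eq_ker_red_of_inf_eq (l N : ℕ+) (μ : D.CyclotomeMod l N) {W : Subgroup D.GtpTheta}
    (hW : D.lDeltaTheta l ⊓ W = D.lDeltaTheta (l * N)) :
    (W ⊓ (ThetaSubquotient.ιTheta D l).range).comap (ThetaSubquotient.ιTheta D l) = μ.red.ker := by
  ext a
  rw [MonoidHom.mem_ker, μ.red_ker, Subgroup.mem_comap, Subgroup.mem_inf]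
  constructor
  · rintro ⟨haW, -⟩
    have ha : (a : D.GtpTheta) ∈ D.lDeltaTheta l ⊓ W := ⟨a.2, haW⟩
    rw [hW] at ha
    obtain ⟨d, hd, hda⟩ := ha
    refine ⟨⟨d ^ (l : ℕ), d, hd, rfl⟩, Subtype.ext ?_⟩
    show (a : D.GtpTheta) = (d ^ (l : ℕ)) ^ (N : ℕ)
    rw [← pow_mul]
    exact hda.symm
  · rintro ⟨y, rfl⟩
    refine ⟨?_, ⟨y ^ (N : ℕ), rfl⟩⟩
    obtain ⟨d, hd, hdy⟩ := y.2
    have : ((y ^ (N : ℕ) : ↥(D.lDeltaTheta l)) : D.GtpTheta) ∈ D.lDeltaTheta (l * N) := by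
      refine ⟨d, hd, ?_⟩
      show d ^ ((l : ℕ) * (N : ℕ)) = ((y : D.GtpTheta)) ^ (N : ℕ)
      rw [pow_mul, hdy]
    rw [← hW] at this
    exact this.2

end ThetaSetting

namespace ThetaSubquotient

variable {p : ℕ} [Fact p.Prime] (D : ThetaSetting p)

/-- The cardinality step shared by both Galois objects: at the single-underline pin, for an open normal `V ⊆ Π^tp_X` with
`l·Δ_Θ ∩ θ(V) = (l·N)·Δ_Θ`, `(l·Δ_Θ)_{Π/V} ≃ l·Δ_Θ ⧸ Ker(red) ≃ μ_N` is cyclic of order `N`, so its quotient by `N`-th powers has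
`N` elements. [cite: MochizukiEtTh2009, Def 5.4 p.327 (PDF p.101)] -/
theorem card_lDeltaModN_ofSetting_of_inf_eq (hT : IsTempered D.PiTemp) (l N : ℕ+) (μ : D.CyclotomeMod l N)
    (V : OpenNormalSubgroup D.PiTemp) (hV : D.lDeltaTheta l ⊓ V.toSubgroup.map D.toTheta = D.lDeltaTheta (l * N)) :
    Nat.card ((ofSetting D l).lDelta ⟨BTemp.Q hT V, isConnectedObj_Q hT V⟩ ⧸
      (powMonoidHom (N : ℕ) : (ofSetting D l).lDelta ⟨BTemp.Q hT V, isConnectedObj_Q hT V⟩ →*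
        (ofSetting D l).lDelta ⟨BTemp.Q hT V, isConnectedObj_Q hT V⟩).range) = N := by
  have hstar := D.comap_ιTheta_eq_ker_red_of_inf_eq l N μ hV
  have e : (ofSetting D l).lDelta ⟨BTemp.Q hT V, isConnectedObj_Q hT V⟩ ≃* MuN p N :=
    ((lDeltaQEquivOfSetting D l hT V).trans (QuotientGroup.quotientMulEquivOfEq hstar)).trans
      (QuotientGroup.quotientKerEquivOfSurjective μ.red μ.red_surjective)
  haveI : Finite ((ofSetting D l).lDelta ⟨BTemp.Q hT V, isConnectedObj_Q hT V⟩) := Finite.of_equiv _ e.symm.toEquiv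
  haveI : IsCyclic ((ofSetting D l).lDelta ⟨BTemp.Q hT V, isConnectedObj_Q hT V⟩) :=
    isCyclic_of_surjective e.symm.toMonoidHom e.symm.surjective
  refine ((ofSetting D l).card_lDelta_quotient_pow_eq_iff_dvd _ N).mpr ?_
  rw [Nat.card_congr e.toEquiv, Nat.card_eq_fintype_card, card_MuN]

/-- **[EtTh] Def. 5.4 (b) TRUE at the setting pin for `Π^tp_X/Π^tp_{Z_{l·N}}`**: `#((l·Δ_Θ)_{Π/Z_{l·N}} ⊗ ℤ/Nℤ) = N`, from the freeness
guard, the ∃-form of the `Z_{l·N}` origin clause and a cyclotome datum (the Galois object is named by the displayed equation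
`V = Π^tp_{Z_{l·N}}`). [cite: MochizukiEtTh2009, Def 5.4 p.327 (PDF p.101)] -/
theorem card_lDeltaModN_ofSetting_gtpZN (hO : D.IsEtThOrigin) (hT : IsTempered D.PiTemp) (l N : ℕ+)
    (μ : D.CyclotomeMod l N) {s₀ : ↥(D.GKN (l * N)) → D.GtpTheta} (hs₀ : D.IsThetaSplittingAt (l * N) s₀)
    (hcl : ∀ g : D.PiTemp, g ∈ D.GtpZN (l * N) ↔ g ∈ D.GtpYN (l * N) ∧ ∃ h : D.aug g ∈ D.GJN (l * N),
      D.toTheta g * (s₀ ⟨D.aug g, D.GJN_le_GKN (l * N) h⟩)⁻¹ ∈ D.thetaPowersY (l * N))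
    (V : OpenNormalSubgroup D.PiTemp) (hVZ : V.toSubgroup = D.GtpZN (l * N)) :
    Nat.card ((ofSetting D l).lDelta ⟨BTemp.Q hT V, isConnectedObj_Q hT V⟩ ⧸
      (powMonoidHom (N : ℕ) : (ofSetting D l).lDelta ⟨BTemp.Q hT V, isConnectedObj_Q hT V⟩ →*
        (ofSetting D l).lDelta ⟨BTemp.Q hT V, isConnectedObj_Q hT V⟩).range) = N := by
  refine card_lDeltaModN_ofSetting_of_inf_eq D hT l N μ V ?_
  rw [hVZ]
  exact D.lDeltaTheta_inf_map_toTheta_gtpZN N hO l hs₀ hcl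

/-- **[EtTh] Def. 5.4 (b) TRUE at the setting pin for `Π^tp_X/Π^tp_{Z̈_{l·N}}`** (the `Z̈`-covering of §5, p. 330), given in addition
`Δ_Θ ≤ θ(Δ^tp_{Y_{2lN}})` (a theorem at Tate origins, next). [cite: MochizukiEtTh2009, Def 5.4 p.327 (PDF p.101)] -/
theorem card_lDeltaModN_ofSetting_gtpZddN (hO : D.IsEtThOrigin) (hT : IsTempered D.PiTemp) (l N : ℕ+)
    (μ : D.CyclotomeMod l N) {s₀ : ↥(D.GKN (l * N)) → D.GtpTheta} (hs₀ : D.IsThetaSplittingAt (l * N) s₀)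
    (hcl : ∀ g : D.PiTemp, g ∈ D.GtpZN (l * N) ↔ g ∈ D.GtpYN (l * N) ∧ ∃ h : D.aug g ∈ D.GJN (l * N),
      D.toTheta g * (s₀ ⟨D.aug g, D.GJN_le_GKN (l * N) h⟩)⁻¹ ∈ D.thetaPowersY (l * N))
    (hΘ : D.DeltaTheta ≤ (D.DtpYN (2 * (l * N))).map D.toTheta)
    (V : OpenNormalSubgroup D.PiTemp) (hVZ : V.toSubgroup = D.GtpZddN (l * N)) :
    Nat.card ((ofSetting D l).lDelta ⟨BTemp.Q hT V, isConnectedObj_Q hT V⟩ ⧸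
      (powMonoidHom (N : ℕ) : (ofSetting D l).lDelta ⟨BTemp.Q hT V, isConnectedObj_Q hT V⟩ →*
        (ofSetting D l).lDelta ⟨BTemp.Q hT V, isConnectedObj_Q hT V⟩).range) = N := by
  refine card_lDeltaModN_ofSetting_of_inf_eq D hT l N μ V ?_
  rw [hVZ]
  have h := D.map_toTheta_gtpZddN_inf_deltaTheta (l * N) hO hs₀ hcl hΘ
  rw [PNat.mul_coe] at h
  exact D.lDeltaTheta_inf_eq_pow_of_deltaTheta_inf l N h

/-- **… and at Tate origins the extra input is discharged** (`IsTateOrigin`, R2 `GtpYNFromCusp` at every level, a cusp in `Π^tp_Y`).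
[cite: MochizukiEtTh2009, Def 5.4 p.327 (PDF p.101)] -/
theorem card_lDeltaModN_ofSetting_gtpZddN_of_isTateOrigin (hO : D.IsEtThOrigin) (hT : IsTempered D.PiTemp)
    (hTa : D.IsTateOrigin) (hR2 : ∀ M : ℕ+, Thm16Sub.GtpYNFromCusp D M)
    (hcusp : ∃ Dc : Subgroup D.PiTemp, D.IsCuspidalDecompositionGroup Dc ∧ Dc ≤ D.GtpY) (l N : ℕ+)
    (μ : D.CyclotomeMod l N) {s₀ : ↥(D.GKN (l * N)) → D.GtpTheta} (hs₀ : D.IsThetaSplittingAt (l * N) s₀)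
    (hcl : ∀ g : D.PiTemp, g ∈ D.GtpZN (l * N) ↔ g ∈ D.GtpYN (l * N) ∧ ∃ h : D.aug g ∈ D.GJN (l * N),
      D.toTheta g * (s₀ ⟨D.aug g, D.GJN_le_GKN (l * N) h⟩)⁻¹ ∈ D.thetaPowersY (l * N))
    (V : OpenNormalSubgroup D.PiTemp) (hVZ : V.toSubgroup = D.GtpZddN (l * N)) :
    Nat.card ((ofSetting D l).lDelta ⟨BTemp.Q hT V, isConnectedObj_Q hT V⟩ ⧸
      (powMonoidHom (N : ℕ) : (ofSetting D l).lDelta ⟨BTemp.Q hT V, isConnectedObj_Q hT V⟩ →*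
        (ofSetting D l).lDelta ⟨BTemp.Q hT V, isConnectedObj_Q hT V⟩).range) = N :=
  card_lDeltaModN_ofSetting_gtpZddN D hO hT l N μ hs₀ hcl
    (D.deltaTheta_le_map_toTheta_dtpYN_of_isTateOrigin hTa hR2 hcusp (2 * (l * N))) V hVZ

end ThetaSubquotient

end Literature.AnabelianGeometry.EtaleTheta

end
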